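import Mathlib
import Summits.KontsevichZagierPeriods.Zeta5Search.SecondOrderLive
import Summits.KontsevichZagierPeriods.Zeta5Search.KDigitResidue
import Summits.KontsevichZagierPeriods.Zeta5Search.KDigitCentre
import Summits.KontsevichZagierPeriods.Zeta5Search.DenomLaw.CentreCompanionEvenK
import Summits.KontsevichZagierPeriods.Zeta5Search.KDigitSecondFunctional
import Summits.KontsevichZagierPeriods.Zeta5Search.PalindromicVDigits
import HarnessLib

/-!
# ζ(5) search — THEOREM A‴ in `𝒦`-form: the DEEP classes and the LIVE SUB-DEEP ORBITS on the `𝒦`-side (DENOM-LAW D1, prover-d1 gen 19)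

HONEST FRAMING: systematic search; no irrationality claim unless certified.  Cell `pub-zeta5`, track «DENOM-LAW» D1, seat
`denom-prover-d1` gen 19 (`HOME/denom-law/prover-d1/ATTEMPT-19.md` §3).  The `𝒦`-row twins of typer g11's `SecondOrderLive.deep_data` /
`live_pair` (which are stated for `(ŵ, v̂)`), for the hypotheses of `SecondOrder.LawA3` (one palindromic deep type `T`, sub-deep classes
single raises of `T` or the odd-centre class of type `T`), with the `𝒦`-DIRECTION
  `τ_K(T) := 2·ĉ₂(T) − L·ĉ(T)`  (`typeC2`, `typeC` of prover-d1 gen 15's `KDigitCentre`, at `(tTop T, tList T)`):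
* `typeC_congr`, `typeC2_congr`, `typeS3_congr`; `cHat2_level₀` (`ĉ₂_x = ĉ₂(T)` on a level class), `sum_rho_three_level₀`;
* `typeS1_consOne`, `typeS2_consOne`, `typeCCorr_eq_zero_of_consClass` — the translation term `corr_C(T)` VANISHES as soon as the
  shifted list `1 :: T` is realised by a class of exponent `≤ −3` (its two realised residue identities give `S₂+S₁ = 0`,
  `S₃ + 2S₂ + S₁ = 0`, and `corr_C = 2S₃ + 3S₂ + S₁ = −(S₂ + S₁) = 0`);
* `typeC_raise_pair` — `ĉ(S) + ĉ(S^rev) = τ_K(T) + [S or S^rev = 1 :: T]·corr_C(T)` for a single raise `S` of the palindrome `T`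
  (gen 15's `typeC_raiseAt`, `typeC_snocOne`, `typeC_consOne`);
* `deep_dataK` — a deep class (type list `T`, palindrome, centre-free, even `E ≤ −4`) has `ĉ_x = 0` and `2ĉ₂_x = τ_K(T)`;
* `live_pairK` — a live sub-deep class `y` (`E_y < 0`, type list a raise of `T`, or the odd-centre class of type `T`) has
  `ĉ_y + ĉ_ȳ = τ_K(T)`.
Numerical certificate of the use (`g19/code/aggtest.py`): the `𝒦`-aggregate of THEOREM A‴ holds with direction `(τ_K, τ_V)` on 309/309
instances at `M = 4` and 141/141 at `M = 6` (`p ≤ 11`).  Finite-sum algebra over `ℚ`; nothing about ζ(5), no γ; records in print UNMOVED.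
-/

noncomputable section

open Finset

namespace Summit.KontsevichZagierPeriods.Zeta5Search.SecondOrder

open Summit.KontsevichZagierPeriods.Zeta5Search.CasoratianValuation (InPolytope)
open Summit.KontsevichZagierPeriods.Zeta5Search.ClusterValuation
open Summit.KontsevichZagierPeriods.Zeta5Search.LevelClass (typeRho typeRho_congr classSet_level level_injective level_mem
  classPoles_level)
open Summit.KontsevichZagierPeriods.Zeta5Search.CellKit (conj_level netExp_conj_level)

variable {p : ℕ} [hp : Fact p.Prime]

/-! ## §1 Congruence of the type functionals in the exponent data -/

omit hp in
/-- `typeC` only sees `e₀,…,e_L`. -/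
theorem typeC_congr {L : ℕ} {e e' : ℕ → ℤ} (h : ∀ k ≤ L, e k = e' k) : typeC L e = typeC L e' := by
  unfold typeC
  rw [filter_congr (fun i hi => by rw [h i (by have := mem_range.1 hi; omega)])]
  refine sum_congr rfl fun i hi => ?_
  have hiL : i ≤ L := by have := mem_range.1 (mem_filter.1 hi).1; omega
  rw [h i hiL, typeRho_congr h hiL, typeRho_congr h hiL]

omit hp in
/-- `typeC2` only sees `e₀,…,e_L`. -/
theorem typeC2_congr {L : ℕ} {e e' : ℕ → ℤ} (h : ∀ k ≤ L, e k = e' k) : typeC2 L e = typeC2 L e' := by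
  unfold typeC2
  rw [filter_congr (fun i hi => by rw [h i (by have := mem_range.1 hi; omega)])]
  refine sum_congr rfl fun i hi => ?_
  have hiL : i ≤ L := by have := mem_range.1 (mem_filter.1 hi).1; omega
  rw [h i hiL, typeRho_congr h hiL, typeRho_congr h hiL, typeRho_congr h hiL]

/-! ## §2 `ĉ₂` and `S₃` of a level class -/

section Level0

variable (b : ℕ → ℤ) {x L : ℕ} (hx : x < p) (hL : x + L * p ≤ (b 0).toNat) (hL' : (b 0).toNat < x + L * p + p)
  (e : ℕ → ℤ) (he : ∀ k ≤ L, netExp b (x + k * p) = e k) (hc0 : ¬ (¬ (2 : ℤ) ∣ b 0 ∧ CentreIn b p x))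
include hx hL hL' he hc0

/-- `ĉ₂_x = ĉ₂(T)` for a level class without odd-centre factor. -/
theorem cHat2_level₀ : cHat2 b p x = typeC2 L e := by
  have hP : (classSet b p x).filter (fun q => netExp b q < 0) =
      ((range (L + 1)).filter fun k => e k < 0).image fun k => x + k * p := classPoles_level b hx hL hL' e he
  unfold cHat2 typeC2 classPoles
  rw [hP, sum_image (fun a _ c _ h => level_injective hp.out.pos x h)]
  refine sum_congr rfl fun k hk => ?_
  have hkL : k ≤ L := by have := mem_range.1 (mem_filter.1 hk).1; omega
  rw [he k hkL, level_div hx, classRho_level₀ b hx hL hL' e he hc0 hkL, classRho_level₀ b hx hL hL' e he hc0 hkL,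
    classRho_level₀ b hx hL hL' e he hc0 hkL]

/-- `Σ([n≥3]ρ₃ + 2ℓ[n≥2]ρ₂ + ℓ²ρ₁) = S₃(T)` for a level class without odd-centre factor. -/
theorem sum_rho_three_level₀ :
    ∑ q ∈ classPoles b p x, ((if netExp b q ≤ -3 then classRho b p q 3 else 0)
        + 2 * ((q / p : ℕ) : ℚ) * (if netExp b q ≤ -2 then classRho b p q 2 else 0)
        + (((q / p : ℕ) : ℚ)) ^ 2 * classRho b p q 1) = typeS3 L e := by
  have hP : (classSet b p x).filter (fun q => netExp b q < 0) =
      ((range (L + 1)).filter fun k => e k < 0).image fun k => x + k * p := classPoles_level b hx hL hL' e he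
  unfold typeS3 classPoles
  rw [hP, sum_image (fun a _ c _ h => level_injective hp.out.pos x h)]
  refine sum_congr rfl fun k hk => ?_
  have hkL : k ≤ L := by have := mem_range.1 (mem_filter.1 hk).1; omega
  rw [he k hkL, level_div hx, classRho_level₀ b hx hL hL' e he hc0 hkL, classRho_level₀ b hx hL hL' e he hc0 hkL,
    classRho_level₀ b hx hL hL' e he hc0 hkL]

end Level0

/-! ## §3 The residue-type sums under `T ↦ 1 :: T` and the vanishing of `corr_C` -/

omit hp in
/-- `S₁(1 :: T) = S₂(T) + S₁(T)`. -/
theorem typeS1_consOne (L : ℕ) (e : ℕ → ℤ) : typeS1 (L + 1) (consOne e) = typeS2 L e + typeS1 L e := by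
  unfold typeS1 typeS2
  rw [sum_filter, sum_filter, sum_filter, ← sum_add_distrib, sum_range_succ',
    show consOne e 0 = 1 by rw [consOne, if_pos rfl], if_neg (by norm_num), add_zero]
  refine sum_congr rfl fun i _ => ?_
  have hr : consOne e (i + 1) = e i := by rw [consOne, if_neg (by omega), Nat.add_sub_cancel]
  simp only [hr]
  by_cases h0 : e i < 0
  · have hρ1 := typeRho_consOne (L := L) e i (σ := 1) (by push_cast; omega)
    simp only [if_pos h0, hρ1]
    split_ifs <;> first | (exfalso; push_cast at *; omega) | (push_cast; ring)
  · simp only [if_neg h0]; ring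

omit hp in
/-- `S₂(1 :: T) = S₃(T) + 2S₂(T) + S₁(T)`. -/
theorem typeS2_consOne (L : ℕ) (e : ℕ → ℤ) :
    typeS2 (L + 1) (consOne e) = typeS3 L e + 2 * typeS2 L e + typeS1 L e := by
  unfold typeS1 typeS2 typeS3
  rw [sum_filter, sum_filter, sum_filter, sum_filter, mul_sum, ← sum_add_distrib, ← sum_add_distrib, sum_range_succ',
    show consOne e 0 = 1 by rw [consOne, if_pos rfl], if_neg (by norm_num), add_zero]
  refine sum_congr rfl fun i _ => ?_
  have hr : consOne e (i + 1) = e i := by rw [consOne, if_neg (by omega), Nat.add_sub_cancel]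
  simp only [hr]
  by_cases h0 : e i < 0
  · have hρ1 := typeRho_consOne (L := L) e i (σ := 1) (by push_cast; omega)
    by_cases h2 : e i ≤ -2
    · have hρ2 := typeRho_consOne (L := L) e i (σ := 2) (by push_cast; omega)
      simp only [if_pos h0, if_pos h2, hρ1, hρ2]
      split_ifs <;> first | (exfalso; push_cast at *; omega) | (push_cast; ring)
    · simp only [if_pos h0, if_neg h2, hρ1]
      split_ifs <;> first | (exfalso; push_cast at *; omega) | (push_cast; ring)
  · simp only [if_neg h0]; ring

/-- **`corr_C(T) = 0` as soon as `1 :: T` is realised**: a level class `y` (levels `0..L+1`, no odd-centre factor) realising `1 :: T` with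
`E_y ≤ −3` has `S₁(1::T) = S₂(1::T) = 0`, whence `corr_C(T) = 2S₃ + 3S₂ + S₁ = 0`. -/
theorem typeCCorr_eq_zero_of_consClass (b : ℕ → ℤ) (hb : InPolytope b) (hp5 : 5 ≤ p) (hwin : (b 0 + 2 : ℤ) < (p : ℤ) ^ 2)
    {y L : ℕ} (hy : y < p) (hM : y + (L + 1) * p ≤ (b 0).toNat) (hM' : (b 0).toNat < y + (L + 1) * p + p)
    (e : ℕ → ℤ) (he : ∀ i ≤ L + 1, netExp b (y + i * p) = consOne e i)
    (hc0 : ¬ (¬ (2 : ℤ) ∣ b 0 ∧ CentreIn b p y)) (hE : classExp b p y ≤ -3) : typeCCorr L e = 0 := by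
  obtain ⟨h1, h2, -⟩ := rhoResidueIdentities_holds b p y hb hp.out hp5 hwin hy
  have e1 := h1 (by omega)
  have e2 := h2 hE
  rw [sum_rho_one_level₀ b hy hM hM' (consOne e) he hc0, typeS1_consOne] at e1
  rw [sum_rho_two_level₀ b hy hM hM' (consOne e) he hc0, typeS2_consOne] at e2
  rw [typeCCorr_eq]
  linear_combination 2 * e2 - e1

/-! ## §4 The raise lemma for the pair `{S, S^rev}`, `𝒦`-component -/

omit hp in
/-- **RAISE LEMMA, `𝒦`-component**: for a palindromic `T = (L, e)` and a single raise `S = (M, f)`,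
`ĉ(S) + ĉ(S^rev) = (2ĉ₂(T) − L ĉ(T)) + [M = L+1]·corr_C(T)`. -/
theorem typeC_raise_pair {L M : ℕ} {e f : ℕ → ℤ} (hpal : ∀ k ≤ L, e (L - k) = e k)
    (h : isRaise ((List.range (L + 1)).map e) ((List.range (M + 1)).map f) = true) :
    typeC M f + typeC M (fun k => f (M - k)) = (2 * typeC2 L e - (L : ℚ) * typeC L e)
      + (if M = L + 1 then typeCCorr L e else 0) := by
  rcases isRaise_level h with ⟨k, hk, hML, hf⟩ | ⟨hML, hf⟩ | ⟨hML, hf⟩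
  · subst hML
    have h1 : typeC M f = typeC M (raiseAt e k) := typeC_congr hf
    have h2 : typeC M (fun j => f (M - j)) = typeC M (raiseAt e (M - k)) := by
      refine typeC_congr fun j hj => ?_
      show f (M - j) = raiseAt e (M - k) j
      rw [hf (M - j) (by omega), raiseAt, raiseAt, hpal j hj]
      by_cases hjk : j = M - k
      · rw [if_pos (by omega), if_pos hjk]
      · rw [if_neg (by omega), if_neg hjk]
    rw [h1, h2, typeC_raiseAt e hk, typeC_raiseAt e (by omega : M - k ≤ M), if_neg (by omega)]
    push_cast [Nat.cast_sub hk]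
    ring
  · subst hML
    have h1 : typeC (L + 1) f = typeC (L + 1) (consOne e) := typeC_congr hf
    have h2 : typeC (L + 1) (fun j => f (L + 1 - j)) = typeC (L + 1) (snocOne e L) := by
      refine typeC_congr fun j hj => ?_
      show f (L + 1 - j) = snocOne e L j
      rw [hf (L + 1 - j) (by omega), consOne, snocOne]
      by_cases hj0 : j = L + 1
      · rw [if_pos (by omega), if_pos hj0]
      · rw [if_neg (by omega), if_neg hj0, ← hpal j (by omega)]
        congr 1; omega
    rw [h1, h2, typeC_consOne, typeC_snocOne, if_pos rfl]
    push_cast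
    ring
  · subst hML
    have h1 : typeC (L + 1) f = typeC (L + 1) (snocOne e L) := typeC_congr hf
    have h2 : typeC (L + 1) (fun j => f (L + 1 - j)) = typeC (L + 1) (consOne e) := by
      refine typeC_congr fun j hj => ?_
      show f (L + 1 - j) = consOne e j
      rw [hf (L + 1 - j) (by omega), consOne, snocOne]
      by_cases hj0 : j = 0
      · rw [if_pos (by omega), if_pos hj0]
      · rw [if_neg (by omega), if_neg hj0, ← hpal (j - 1) (by omega)]
        congr 1; omega
    rw [h1, h2, typeC_consOne, typeC_snocOne, if_pos rfl]
    push_cast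
    ring

/-! ## §5 Deep classes, `𝒦`-side -/

section Deep

variable (b : ℕ → ℤ) (hb : InPolytope b) (hp5 : 5 ≤ p) (hpn : (p : ℤ) ≤ b 0) (hwin : (b 0 + 2 : ℤ) < (p : ℤ) ^ 2)
  {T : List ℤ} (hT : T.reverse = T) {x : ℕ} (hx : x < p) (hc : ¬ CentreIn b p x) (htl : classTypeList b p x = T)
include hb hp5 hpn hwin hT hx hc htl

/-- **Deep-class data, `𝒦`-side.**  A centre-free class with palindromic type list `T` and even exponent `E_x ≤ −4` has
`ĉ_x = 0` and `2ĉ₂_x = τ_K(T) = 2ĉ₂(T) − L ĉ(T)` (and `ĉ(T) = 0`). -/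
theorem deep_dataK (hE : classExp b p x ≤ -4) (heven : Even (classExp b p x)) :
    cHat b p x = 0 ∧ typeC (tTop T) (tList T) = 0 ∧ cHat2 b p x = typeC2 (tTop T) (tList T) := by
  have h0 : 0 ≤ b 0 := hb.1.1
  have hxn := le_b0_of_lt b hpn hx
  obtain ⟨hL, hL'⟩ := level_bounds' (p := p) b hxn
  obtain ⟨htop, he⟩ := spec_of_typeList b hxn htl
  set L := topLevel b p x with hLdef
  have hpal : ∀ k ≤ L, netExp b (x + (L - k) * p) = netExp b (x + k * p) := by
    intro k hk
    rw [he k hk, he (L - k) (by omega), ← htop]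
    exact tList_pal hT k (by omega)
  have hc0 : ¬ (¬ (2 : ℤ) ∣ b 0 ∧ CentreIn b p x) := fun h => hc h.2
  -- `ĉ_x = 0` by the palindrome involution (typer g9's `cHat_eq_zero_of_pal`)
  have hpal' : ∀ s ∈ classSet b p x, netExp b s = netExp b ((b 0).toNat - ((b 0).toNat - x) % p - (s - x)) := by
    intro s hs
    rw [classSet_level b hx hL hL'] at hs
    obtain ⟨k, hk, rfl⟩ := mem_image.1 hs
    have hkL : k ≤ L := by have := mem_range.1 hk; omega
    have hmod : ((b 0).toNat - x) % p = (b 0).toNat - x - L * p := by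
      have h1 := Nat.div_add_mod ((b 0).toNat - x) p
      have h2 : ((b 0).toNat - x) / p = L := rfl
      rw [h2] at h1
      have : p * L = L * p := mul_comm _ _
      omega
    have e1 : (b 0).toNat - ((b 0).toNat - x) % p - (x + k * p - x) = x + (L - k) * p := by
      rw [hmod, Nat.add_sub_cancel_left]
      have : (L - k) * p + k * p = L * p := by rw [← Nat.add_mul, Nat.sub_add_cancel hkL]
      omega
    rw [e1, hpal k hkL]
  have hc1 : cHat b p x = 0 := cHat_eq_zero_of_pal b hb hp.out hp5 hwin hx hc hpal' (by omega) heven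
  have hcT : cHat b p x = typeC (tTop T) (tList T) := by
    rw [cHat_level₀ b hx hL hL' _ (fun k _ => rfl) hc0, htop]; exact typeC_congr he
  refine ⟨hc1, by rw [← hcT, hc1], ?_⟩
  rw [cHat2_level₀ b hx hL hL' _ (fun k _ => rfl) hc0, htop]
  exact typeC2_congr he

end Deep

/-! ## §6 Live sub-deep classes, `𝒦`-side -/

section Live

variable (b : ℕ → ℤ) (hb : InPolytope b) (hp5 : 5 ≤ p) (hpn : (p : ℤ) ≤ b 0) (hwin : (b 0 + 2 : ℤ) < (p : ℤ) ^ 2)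
  {T : List ℤ} (hT : T.reverse = T) {y : ℕ} (hy : y < p) (hpole : 1 ≤ classPoleCount b p y) (hE3 : classExp b p y ≤ -3)
include hb hp5 hpn hwin hT hy hpole hE3

/-- **LIVE PAIR, `𝒦`-side.**  If the type list of the pole class `y` (`E_y ≤ −3`) is a single raise of the palindrome `T`, or `y` is the
odd-centre class with type list `T`, then `ĉ_y + ĉ_ȳ = τ_K(T) = 2ĉ₂(T) − L ĉ(T)`. -/
theorem live_pairK
    (h4 : isRaise T (classTypeList b p y) = true ∨ (¬ (2 : ℤ) ∣ b 0 ∧ CentreIn b p y ∧ classTypeList b p y = T)) :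
    cHat b p y + cHat b p (conjClass b p y) = 2 * typeC2 (tTop T) (tList T) - (tTop T : ℚ) * typeC (tTop T) (tList T) := by
  have h0 : 0 ≤ b 0 := hb.1.1
  have hp0 : 0 < p := hp.out.pos
  have hyn := le_b0_of_lt b hpn hy
  have hpnN : p ≤ (b 0).toNat := by have := hb.1.1; omega
  obtain ⟨hL, hL'⟩ := level_bounds' (p := p) b hyn
  set M := topLevel b p y with hMdef
  set f : ℕ → ℤ := fun k => netExp b (y + k * p) with hfdef
  have hf : ∀ k ≤ M, netExp b (y + k * p) = f k := fun k _ => rfl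
  have hpalT := tList_pal hT
  have hneg : classExp b p y < 0 := by omega
  -- a pole among the levels
  have hfneg : ∃ i ≤ M, f i < 0 := by
    obtain ⟨q, hq⟩ := card_pos.1 (show 0 < ((classSet b p y).filter fun s => netExp b s < 0).card from hpole)
    have hP : (classSet b p y).filter (fun s => netExp b s < 0) =
        ((range (M + 1)).filter fun k => f k < 0).image fun k => y + k * p := classPoles_level b hy hL hL' f hf
    rw [hP] at hq
    obtain ⟨k, hk, -⟩ := mem_image.1 hq
    obtain ⟨hkr, hkneg⟩ := mem_filter.1 hk
    exact ⟨k, by have := mem_range.1 hkr; omega, hkneg⟩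
  -- the conjugate class: levels `0..M`, exponents reversed, same centre status
  obtain ⟨hy', hM2, hM2'⟩ := conj_level b hy hL hL'
  have hfc : ∀ k ≤ M, netExp b (conjClass b p y + k * p) = f (M - k) := fun k hk => netExp_conj_level b hL hL' h0 hk
  rcases h4 with hr | ⟨hodd, hcen, htl⟩
  · -- Case A: a single raise of `T`
    have hTne : T ≠ [] := by
      rintro rfl
      rw [classTypeList_level b hL hL'] at hr
      unfold isRaise at hr
      simp only [List.length_nil, List.range_zero, List.any_nil, Bool.false_or, Bool.or_eq_true, beq_iff_eq,
        List.nil_append, or_self] at hr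
      have h1 := congrArg List.length hr
      simp only [List.length_map, List.length_range, List.length_cons, List.length_nil] at h1
      have hM0 : M = 0 := by omega
      obtain ⟨i, hi, hfi⟩ := hfneg
      have hi0 : i = 0 := by omega
      subst hi0
      rw [hM0] at hr
      have h01 : netExp b y = 1 := by simpa using hr
      have h02 : f 0 = netExp b y := by show netExp b (y + 0 * p) = _; simp
      omega
    rw [← range_map_tList hTne, classTypeList_level b hL hL'] at hr
    -- no odd centre in the class of `y`
    have hc0 : ¬ (¬ (2 : ℤ) ∣ b 0 ∧ CentreIn b p y) := by
      rintro ⟨hodd, hcen⟩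
      have hself := (centreIn_iff_conjClass_eq b hpnN hy).1 hcen
      have hfpal : ∀ k ≤ M, f (M - k) = f k := by
        intro k hk; rw [← hfc k hk, hself]
      have h2 := even_of_pal_raise hpalT hfpal hfneg hr
      exact odd_L_of_centre b hy hL hL' hodd hcen h0 h2
    have hc0' : ¬ (¬ (2 : ℤ) ∣ b 0 ∧ CentreIn b p (conjClass b p y)) :=
      fun h => hc0 ⟨h.1, (centreIn_conj_iff b h0 hyn).1 h.2⟩
    have hcy : cHat b p y = typeC M f := cHat_level₀ b hy hL hL' f hf hc0
    have hcc : cHat b p (conjClass b p y) = typeC M (fun k => f (M - k)) := cHat_level₀ b hy' hM2 hM2' _ hfc hc0'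
    rw [hcy, hcc, typeC_raise_pair hpalT hr]
    -- the translation term vanishes
    by_cases hML : M = tTop T + 1
    · rw [if_pos hML]
      have hcorr : typeCCorr (tTop T) (tList T) = 0 := by
        rcases isRaise_level hr with ⟨k, hk, hML', -⟩ | ⟨-, hfi⟩ | ⟨-, hfi⟩
        · omega
        · -- `y` itself realises `1 :: T`
          rw [hML] at hL hL'
          exact typeCCorr_eq_zero_of_consClass b hb hp5 hwin hy hL hL' (tList T) (fun i hi => by rw [← hfi i hi]) hc0 hE3
        · -- the conjugate class realises `1 :: T`
          rw [hML] at hM2 hM2'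
          refine typeCCorr_eq_zero_of_consClass b hb hp5 hwin hy' hM2 hM2' (tList T) (fun i hi => ?_) hc0'
            (by rw [classExp_conj b h0 hyn]; exact hE3)
          rw [hfc i (by omega)]
          show netExp b (y + (M - i) * p) = consOne (tList T) i
          rw [hfi (M - i) (by omega), snocOne, consOne]
          by_cases hi0 : i = 0
          · rw [if_pos (by omega), if_pos hi0]
          · rw [if_neg (by omega), if_neg hi0, show M - i = tTop T - (i - 1) by omega, hpalT (i - 1) (by omega)]
      rw [hcorr, add_zero]
    · rw [if_neg hML, add_zero]
  · -- Case B: the odd-centre class of type `T`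
    obtain ⟨htop, he⟩ := spec_of_typeList b hyn htl
    have hself := (centreIn_iff_conjClass_eq b hpnN hy).1 hcen
    have hMT : M = tTop T := by rw [hMdef, ← htop]
    have he' : ∀ k ≤ tTop T, f k = tList T k := fun k hk => he k (by rw [← htop]; exact hk)
    rw [hself, cHat_centre_level b hy hL hL' hodd hcen hb _ hf, hMT, typeC2_congr he', typeC_congr he']
    ring

end Live

end Summit.KontsevichZagierPeriods.Zeta5Search.SecondOrder

end
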